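import Literature.NumberTheory.Sieve.ShiuTheoremProofs
import HarnessLib

/-!
# Shiu's Brun–Titchmarsh theorem for multiplicative functions, uniform in the function

Topic `Literature/NumberTheory/Sieve`, companion of `ShiuTheoremProofs.lean` (which discharges the
named fact `Shiu1980BrunTitchmarsh`). Everything here is PROVED and no definition is introduced.

The vendored statement `Shiu1980BrunTitchmarsh` quantifies `∀ f, ∃ C x₀, …`, hiding the fact —
explicit in Shiu's paper (the implied constant depends on `A₁`, `A₂`, `ε`, `θ`) and in the tree's
proof (`Shiu.main_bound`, constant `Shiu.Ctot B A C₁ θ ε M M₁`) — that `C` and `x₀` depend on `f` ONLY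
through the constants `A₁` (prime-power bound `f(p^l) ≤ A₁^l`) and `A₂(δ)` (`f(n) ≤ A₂(δ) n^δ`).
This uniformity is what applications to FAMILIES of functions need, e.g. `f_z(n) = τ(n)^k 𝟙_{(n,P(z))=1}`
(divisor moments over `z`-rough numbers, uniformly in `z`; Matomäki–Merikoski arXiv:2112.11412, §3.1).
We re-run the (short) final assembly of `ShiuTheoremProofs.lean` with the quantifiers in that order:

* `shiu_uniform` — for `A₁ ≥ 0`, `A₂ : ℝ → ℝ`, `0 < ε, θ < 1/2` there are `C ≥ 0`, `x₀` such that for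
  EVERY `f ≥ 0` with `f(mn) = f(m)f(n)` (`(m,n) = 1`), `f(p^l) ≤ A₁^l`, `f(n) ≤ A₂(δ) n^δ` (`δ > 0`),
  and all `x ≥ x₀`, `x^ε ≤ y ≤ x`, `1 ≤ q < y^{1−θ}`, `(a, q) = 1`:
  `∑_{x < n ≤ x+y, n ≡ a (q)} f(n) ≤ C y/(φ(q) log x) · exp(∑_{p ≤ x, p ∤ q} f(p)/p)`.

## References

* P. Shiu, *A Brun–Titchmarsh theorem for multiplicative functions*, J. reine angew. Math. 313 (1980),
  161–170, Theorem 1 (with the dependence of the constant as stated there). [cite: Shiu1980, Theorem 1]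
* K. Matomäki, J. Merikoski, IMRN 2023 (arXiv:2112.11412), §3.1. [cite: MatomakiMerikoski2023, §3.1]
-/

open Finset Real

namespace Literature.NumberTheory.Sieve

open Shiu in
set_option maxHeartbeats 800000 in
/-- **Shiu's theorem, uniformly in `f`** (Shiu 1980, Theorem 1: the implied constant depends only on
`A₁, A₂, ε, θ`). For `A₁ ≥ 0`, `A₂ : ℝ → ℝ` and `0 < ε, θ < 1/2` there are `C ≥ 0` and `x₀` such that
for every nonnegative `f` with `f(mn) = f(m) f(n)` for coprime `m, n`, `f(p^l) ≤ A₁^l` and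
`f(n) ≤ A₂(δ) n^δ` (`δ > 0`, `n ≥ 1`), all `x ≥ x₀`, `x^ε ≤ y ≤ x`, `1 ≤ q < y^{1−θ}` and `(a,q) = 1`:
`∑_{x < n ≤ x+y, n ≡ a (q)} f(n) ≤ C y/(φ(q) log x) exp(∑_{p ≤ x, p ∤ q} f(p)/p)`.
[cite: Shiu1980, Theorem 1] -/
theorem shiu_uniform {A₁ : ℝ} (hA₁0 : 0 ≤ A₁) (A₂ : ℝ → ℝ) {ε θ : ℝ} (hε : 0 < ε) (hε2 : ε < 1 / 2)
    (hθ : 0 < θ) (hθ2 : θ < 1 / 2) :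
    ∃ C x₀ : ℝ, 0 ≤ C ∧ ∀ f : ℕ → ℝ, (∀ n, 0 ≤ f n) → (∀ m n : ℕ, m.Coprime n → f (m * n) = f m * f n) →
      (∀ p l : ℕ, p.Prime → 1 ≤ l → f (p ^ l) ≤ A₁ ^ l) →
      (∀ δ : ℝ, 0 < δ → ∀ n : ℕ, 1 ≤ n → f n ≤ A₂ δ * (n : ℝ) ^ δ) →
      ∀ x y : ℝ, x₀ ≤ x → x ^ ε ≤ y → y ≤ x →
        ∀ q : ℕ, 1 ≤ q → (q : ℝ) < y ^ (1 - θ) → ∀ a : ℕ, a.Coprime q →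
          ∑ n ∈ (Finset.Icc 1 ⌊x + y⌋₊).filter (fun n : ℕ => x < n ∧ (n : ZMod q) = (a : ZMod q)),
              f n ≤
            C * y / ((Nat.totient q : ℝ) * Real.log x) *
              Real.exp (∑ p ∈ (Finset.Icc 1 ⌊x⌋₊).filter (fun p : ℕ => p.Prime ∧ ¬p ∣ q),
                f p / p) := by
  -- constants (independent of `f`)
  obtain ⟨C₁, hC₁, hsieve⟩ := segment_sieve_bound
  set B : ℝ := max A₁ 2 with hB_def
  have hB1 : 1 ≤ B := le_trans one_le_two (le_max_right _ _)
  set A : ℝ := A₂ (1 / 6) with hA_def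
  set δ₀ : ℝ := ε * θ / 240 with hδ₀_def
  have hδ₀ : 0 < δ₀ := by positivity
  have hεθ : 0 < ε * θ := mul_pos hε hθ
  have hδ₀1 : δ₀ ≤ 1 := by
    have : ε * θ ≤ 1 := mul_le_one₀ (by linarith) hθ.le (by linarith)
    rw [hδ₀_def]; linarith
  set A₀ : ℝ := A₂ δ₀ with hA₀_def
  set M : ℕ := ⌈40 / (θ * ε)⌉₊ with hM_def
  set M₁ : ℕ := ⌈20 / (θ * ε)⌉₊ with hM₁_def
  set K₁ : ℝ := 2 * M₁ * Real.log B + 4 * Real.log 2 with hK₁_def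
  set L : ℝ := Real.exp (6 * K₁) with hL_def
  set N : ℕ := ⌊L⌋₊ + 1 with hN_def
  have hK₁4 : 4 * Real.log 2 ≤ K₁ := by
    have : 0 ≤ 2 * (M₁ : ℝ) * Real.log B := by
      have := Real.log_nonneg hB1; positivity
    linarith
  have hL4 : 4 ≤ L := by
    have hlog4 : Real.log 4 = 2 * Real.log 2 := by
      rw [show (4 : ℝ) = 2 ^ 2 by norm_num, Real.log_pow]; ring
    have h1 : Real.log 4 ≤ 6 * K₁ := by
      rw [hlog4]; linarith [Real.log_pos one_lt_two]
    calc (4 : ℝ) = Real.exp (Real.log 4) := (Real.exp_log (by norm_num)).symm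
      _ ≤ L := Real.exp_le_exp.2 h1
  have hLK : 6 * (2 * M₁ * Real.log B + 4 * Real.log 2) ≤ Real.log L := by
    rw [hL_def, Real.log_exp]
  have hLN : L < N := by rw [hN_def]; push_cast; exact Nat.lt_floor_add_one L
  -- the threshold
  have hev : ∀ᶠ x : ℝ in Filter.atTop, 2 ≤ x ∧ (2 : ℝ) ^ (20 / θ) ≤ x ^ ε ∧
      1 * x ^ (0 : ℝ) * Real.log x ≤ x ^ (ε * (17 * θ / 20)) ∧
      28 * A₀ * x ^ δ₀ * Real.log x ≤ x ^ (ε * (θ / 60)) ∧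
      2 * A₀ * x ^ δ₀ * Real.log x ≤ x ^ (ε * (19 * θ / 20)) ∧
      4 * A₀ * KL N * x ^ δ₀ * Real.log x ≤ x ^ (ε * (θ / 60)) ∧
      4 * A₀ * KL' N * x ^ δ₀ * Real.log x ≤ x ^ (ε * (19 * θ / 20)) ∧
      1 * x ^ (0 : ℝ) * Real.log x ≤ x ^ (ε * (13 * θ / 15)) := by
    have hδ₁ : δ₀ < ε * (θ / 60) := by rw [hδ₀_def]; linarith
    have hδ₂ : δ₀ < ε * (19 * θ / 20) := by rw [hδ₀_def]; linarith
    refine (Filter.eventually_ge_atTop 2).and (((tendsto_rpow_atTop hε).eventually_ge_atTop _).and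
      ((eventually_mul_rpow_mul_log_le 1 (by positivity)).and
      ((eventually_mul_rpow_mul_log_le _ hδ₁).and ((eventually_mul_rpow_mul_log_le _ hδ₂).and
      ((eventually_mul_rpow_mul_log_le _ hδ₁).and ((eventually_mul_rpow_mul_log_le _ hδ₂).and
      (eventually_mul_rpow_mul_log_le 1 (by positivity))))))))
  obtain ⟨x₀, hx₀⟩ := Filter.eventually_atTop.1 hev
  refine ⟨max (Ctot B A C₁ θ ε M M₁) 0, x₀, le_max_right _ _, ?_⟩
  intro f hf0 hmul hA₁ hA₂ x y hx hxy hyx q hq hqy a haq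
  obtain ⟨hx2, h7, e1, e2, e3, e4, e5, e6⟩ := hx₀ x hx
  have hRHS0 : 0 ≤ max (Ctot B A C₁ θ ε M M₁) 0 * y / ((Nat.totient q : ℝ) * Real.log x) *
      Real.exp (∑ p ∈ (Finset.Icc 1 ⌊x⌋₊).filter (fun p : ℕ => p.Prime ∧ ¬p ∣ q), f p / p) := by
    have hy0 : 0 ≤ y := le_trans (Real.rpow_nonneg (by linarith) ε) hxy
    have : 0 ≤ Real.log x := Real.log_nonneg (by linarith)
    positivity
  by_cases hf1 : f 1 = 1
  swap
  · -- degenerate case: `f 1 = f 1 ^ 2 ≠ 1` forces `f ≡ 0`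
    have hf1' : f 1 = 0 := by
      have h := hmul 1 1 (Nat.coprime_one_left 1)
      rw [mul_one] at h
      have h2 : f 1 * (f 1 - 1) = 0 := by nlinarith [h]
      rcases mul_eq_zero.1 h2 with h0 | h0
      · exact h0
      · exact absurd (by linarith : f 1 = 1) hf1
    have hzero : ∀ n, f n = 0 := fun n => by
      have h := hmul 1 n (Nat.coprime_one_left n)
      rw [one_mul, hf1', zero_mul] at h
      exact h
    rw [Finset.sum_eq_zero (fun n _ => hzero n)]
    exact hRHS0
  have hBf : ∀ p l : ℕ, p.Prime → 1 ≤ l → f (p ^ l) ≤ B ^ l := fun p l hp hl =>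
    (hA₁ p l hp hl).trans (pow_le_pow_left₀ hA₁0 (le_max_left _ _) l)
  have hA : ∀ n : ℕ, 1 ≤ n → f n ≤ A * (n : ℝ) ^ (1 / 6 : ℝ) := hA₂ (1 / 6) (by norm_num)
  have hA₀ : ∀ n : ℕ, 1 ≤ n → f n ≤ A₀ * (n : ℝ) ^ δ₀ := hA₂ δ₀ hδ₀
  have hA₀0 : 0 ≤ A₀ := by
    have h := hA₀ 1 le_rfl
    rw [hf1, Nat.cast_one, Real.one_rpow, mul_one] at h
    linarith
  have hq0 : 0 < q := hq
  have hx0 : 0 < x := by linarith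
  have hx1 : 1 ≤ x := by linarith
  have hlogx : 0 < Real.log x := Real.log_pos (by linarith)
  have hy1 : 1 ≤ y := le_trans (Real.one_le_rpow hx1 hε.le) hxy
  have hy0 : 0 < y := by linarith
  rw [Real.rpow_zero, mul_one, one_mul] at e1 e6
  have hpow : ∀ κ : ℝ, 0 ≤ κ → x ^ (ε * κ) ≤ y ^ κ := fun κ hκ => rpow_mul_le_rpow hx0.le hxy hκ
  -- `w` and `z`
  set w : ℝ := y ^ (θ / 20) with hw_def
  set z : ℝ := w * w with hz_def
  have hw0 : 0 < w := Real.rpow_pos_of_pos hy0 _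
  have hw2 : 2 ≤ w := by
    have h1 : ((2 : ℝ) ^ (20 / θ)) ^ (θ / 20) ≤ y ^ (θ / 20) :=
      Real.rpow_le_rpow (by positivity) (h7.trans hxy) (by positivity)
    have h20 : (20 : ℝ) / θ * (θ / 20) = 1 := by
      rw [div_mul_div_comm, mul_comm (20 : ℝ) θ]
      exact div_self (by positivity)
    rw [← Real.rpow_mul (by norm_num), h20, Real.rpow_one] at h1
    exact h1
  have hzy : z = y ^ (θ / 10) := by
    rw [hz_def, hw_def, ← Real.rpow_add hy0]; ring_nf
  -- `F`
  set F : ℝ := 2 * A₀ * x ^ δ₀ with hF_def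
  have hF0 : 0 ≤ F := by positivity
  have hF : ∀ n ∈ mainSet x y q a, f n ≤ F := by
    intro n hn
    obtain ⟨-, hnxy, hn2, -⟩ := mainSet_props hx1 hy0.le hn
    have hn1 : 1 ≤ n := by omega
    have hn2x : (n : ℝ) ≤ 2 * x := by linarith
    calc f n ≤ A₀ * (n : ℝ) ^ δ₀ := hA₀ n hn1
      _ ≤ A₀ * (2 * x) ^ δ₀ := mul_le_mul_of_nonneg_left
          (Real.rpow_le_rpow (Nat.cast_nonneg n) hn2x hδ₀.le) hA₀0
      _ = A₀ * 2 ^ δ₀ * x ^ δ₀ := by rw [Real.mul_rpow (by norm_num) hx0.le]; ring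
      _ ≤ A₀ * 2 * x ^ δ₀ := by
          refine mul_le_mul_of_nonneg_right (mul_le_mul_of_nonneg_left ?_ hA₀0) (by positivity)
          conv_rhs => rw [← Real.rpow_one 2]
          exact Real.rpow_le_rpow_of_exponent_le one_le_two hδ₀1
      _ = F := by rw [hF_def]; ring
  -- `M`, `M₁`
  have hlogy : ε * Real.log x ≤ Real.log y := by
    have := Real.log_le_log (by positivity) hxy
    rwa [Real.log_rpow hx0] at this
  have hlogw : Real.log w = θ / 20 * Real.log y := by rw [hw_def, Real.log_rpow hy0]
  have hlogz : Real.log z = θ / 10 * Real.log y := by rw [hzy, Real.log_rpow hy0]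
  have hlog2x : Real.log (2 * x) ≤ 2 * Real.log x := by
    rw [Real.log_mul two_ne_zero hx0.ne']
    linarith [Real.log_le_log two_pos hx2]
  have hθε : 0 < θ * ε := mul_pos hθ hε
  have hθlogy : θ * (ε * Real.log x) ≤ θ * Real.log y := mul_le_mul_of_nonneg_left hlogy hθ.le
  have hcancel : 40 / (θ * ε) * (θ * ε) = 40 := div_mul_cancel₀ _ hθε.ne'
  have hM : Real.log (2 * x) / Real.log w ≤ M := by
    have hlw : θ * ε / 20 * Real.log x ≤ Real.log w := by rw [hlogw]; linarith
    have hlw0 : 0 < Real.log w := lt_of_lt_of_le (by positivity) hlw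
    rw [div_le_iff₀ hlw0]
    have h1 : (40 / (θ * ε) : ℝ) ≤ M := Nat.le_ceil _
    have h2 : 2 * Real.log x ≤ 40 / (θ * ε) * Real.log w := by
      have := mul_le_mul_of_nonneg_left hlw (by positivity : (0 : ℝ) ≤ 40 / (θ * ε))
      have heq : 40 / (θ * ε) * (θ * ε / 20 * Real.log x) = 2 * Real.log x := by
        calc 40 / (θ * ε) * (θ * ε / 20 * Real.log x)
            = (40 / (θ * ε) * (θ * ε)) / 20 * Real.log x := by ring
          _ = 2 * Real.log x := by rw [hcancel]; ring
      linarith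
    have h3 := mul_le_mul_of_nonneg_right h1 hlw0.le
    linarith
  have hM₁ : Real.log (2 * x) / Real.log z ≤ M₁ := by
    have hlz : θ * ε / 10 * Real.log x ≤ Real.log z := by rw [hlogz]; linarith
    have hlz0 : 0 < Real.log z := lt_of_lt_of_le (by positivity) hlz
    rw [div_le_iff₀ hlz0]
    have h1 : (20 / (θ * ε) : ℝ) ≤ M₁ := Nat.le_ceil _
    have h2 : 2 * Real.log x ≤ 20 / (θ * ε) * Real.log z := by
      have := mul_le_mul_of_nonneg_left hlz (by positivity : (0 : ℝ) ≤ 20 / (θ * ε))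
      have heq : 20 / (θ * ε) * (θ * ε / 10 * Real.log x) = 2 * Real.log x := by
        calc 20 / (θ * ε) * (θ * ε / 10 * Real.log x)
            = (40 / (θ * ε) * (θ * ε)) / 20 * Real.log x := by ring
          _ = 2 * Real.log x := by rw [hcancel]; ring
      linarith
    have h3 := mul_le_mul_of_nonneg_right h1 hlz0.le
    linarith
  -- the largeness hypotheses
  have hw13 : w ^ (1 / 3 : ℝ) = y ^ (θ / 60) := by
    rw [hw_def, ← Real.rpow_mul hy0.le]; ring_nf
  have HI : w * z * Real.log x ≤ y ^ θ := by
    have h1 : w * z = y ^ (3 * θ / 20) := by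
      rw [hzy, hw_def, ← Real.rpow_add hy0]; ring_nf
    have h2 : Real.log x ≤ y ^ (17 * θ / 20) := e1.trans (hpow _ (by positivity))
    have h3 : y ^ (3 * θ / 20) * y ^ (17 * θ / 20) = y ^ θ := by
      rw [← Real.rpow_add hy0]; ring_nf
    rw [h1, ← h3]
    exact mul_le_mul_of_nonneg_left h2 (by positivity)
  have HII₁ : 14 * F * Real.log x ≤ w ^ (1 / 3 : ℝ) := by
    rw [hw13]
    calc 14 * F * Real.log x = 28 * A₀ * x ^ δ₀ * Real.log x := by rw [hF_def]; ring
      _ ≤ x ^ (ε * (θ / 60)) := e2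
      _ ≤ y ^ (θ / 60) := hpow _ (by positivity)
  have hsplitθ : y ^ (19 * θ / 20) * w = y ^ θ := by
    rw [hw_def, ← Real.rpow_add hy0]; ring_nf
  have HII₂ : F * w * Real.log x ≤ y ^ θ := by
    calc F * w * Real.log x = (2 * A₀ * x ^ δ₀ * Real.log x) * w := by rw [hF_def]; ring
      _ ≤ x ^ (ε * (19 * θ / 20)) * w := mul_le_mul_of_nonneg_right e3 hw0.le
      _ ≤ y ^ (19 * θ / 20) * w := mul_le_mul_of_nonneg_right (hpow _ (by positivity)) hw0.le
      _ = y ^ θ := hsplitθ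
  have HIII₁ : 2 * F * KL N * Real.log x ≤ w ^ (1 / 3 : ℝ) := by
    rw [hw13]
    calc 2 * F * KL N * Real.log x = 4 * A₀ * KL N * x ^ δ₀ * Real.log x := by rw [hF_def]; ring
      _ ≤ x ^ (ε * (θ / 60)) := e4
      _ ≤ y ^ (θ / 60) := hpow _ (by positivity)
  have HIII₂ : 2 * F * w * KL' N * Real.log x ≤ y ^ θ := by
    calc 2 * F * w * KL' N * Real.log x = (4 * A₀ * KL' N * x ^ δ₀ * Real.log x) * w := by
          rw [hF_def]; ring
      _ ≤ x ^ (ε * (19 * θ / 20)) * w := mul_le_mul_of_nonneg_right e5 hw0.le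
      _ ≤ y ^ (19 * θ / 20) * w := mul_le_mul_of_nonneg_right (hpow _ (by positivity)) hw0.le
      _ = y ^ θ := hsplitθ
  have HIV : z ^ (1 / 3 : ℝ) * z * Real.log x ≤ y ^ θ := by
    have h1 : z ^ (1 / 3 : ℝ) * z = y ^ (2 * θ / 15) := by
      rw [hzy, ← Real.rpow_mul hy0.le, ← Real.rpow_add hy0]; ring_nf
    have h2 : Real.log x ≤ y ^ (13 * θ / 15) := e6.trans (hpow _ (by positivity))
    have h3 : y ^ (2 * θ / 15) * y ^ (13 * θ / 15) = y ^ θ := by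
      rw [← Real.rpow_add hy0]; ring_nf
    rw [h1, ← h3]
    exact mul_le_mul_of_nonneg_left h2 (by positivity)
  -- the main bound
  have hmain := main_bound hf0 hf1 hmul hB1 hBf hA hε hθ (by linarith) hx2 hxy hyx hq0 hqy haq
    hw_def hz_def hw2 hF0 hF hM hM₁ hL4 hLK hLN hC₁ (hsieve q hq0) HI HII₁ HII₂ HIII₁ HIII₂ HIV
  -- rewrite the statement's sum and right-hand side
  have hset : (Finset.Icc 1 ⌊x + y⌋₊).filter (fun n : ℕ => x < n ∧ (n : ZMod q) = (a : ZMod q)) =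
      mainSet x y q a := by
    ext n
    rw [mem_mainSet, Finset.mem_filter, Finset.mem_Icc, ZMod.natCast_eq_natCast_iff,
      Nat.floor_lt hx0.le]
    constructor
    · rintro ⟨⟨-, h2⟩, h3, h4⟩
      exact ⟨h3, h2, h4⟩
    · rintro ⟨h1, h2, h3⟩
      have : (1 : ℝ) ≤ n := by linarith
      exact ⟨⟨by exact_mod_cast this, h2⟩, h1, h3⟩
  rw [hset]
  refine hmain.trans ?_
  rw [Esum]
  have hfac0 : 0 ≤ y / ((Nat.totient q : ℝ) * Real.log x) *
      Real.exp (∑ p ∈ (Icc 1 ⌊x⌋₊).filter (fun p : ℕ => p.Prime ∧ ¬ p ∣ q), f p / p) := by positivity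
  calc Ctot B A C₁ θ ε M M₁ * (y / ((Nat.totient q : ℝ) * Real.log x)) *
        Real.exp (∑ p ∈ (Icc 1 ⌊x⌋₊).filter (fun p : ℕ => p.Prime ∧ ¬ p ∣ q), f p / p)
      = Ctot B A C₁ θ ε M M₁ * (y / ((Nat.totient q : ℝ) * Real.log x) *
        Real.exp (∑ p ∈ (Icc 1 ⌊x⌋₊).filter (fun p : ℕ => p.Prime ∧ ¬ p ∣ q), f p / p)) := by ring
    _ ≤ max (Ctot B A C₁ θ ε M M₁) 0 * (y / ((Nat.totient q : ℝ) * Real.log x) *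
        Real.exp (∑ p ∈ (Icc 1 ⌊x⌋₊).filter (fun p : ℕ => p.Prime ∧ ¬ p ∣ q), f p / p)) :=
        mul_le_mul_of_nonneg_right (le_max_left _ _) hfac0
    _ = _ := by ring

end Literature.NumberTheory.Sieve
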